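import Summits.QuantumFields.BalabanUV.Beta.GAN24.CapacitanceScalarRate

/-!
# `BalabanUV.Beta.GAN24.CapacitanceScalarRateTerm` — binder row G-an2-4 / (CONV-C), road P1-fibre, leaf **P1-Y11s** of
# `GAN24/Formal/LEAVES.md` v2.1 — PART 2 of 4: the SUMMANDS of `ã_κ`, `σ̃` versus their continuum references, and the ALIAS WINDOWS

NOT IN PRINT; OUR PROOF ATTEMPT.  HONEST FRAMING (cell contract, verbatim): «discharging `BetaPertH` makes Bałaban's UV stability
UNCONDITIONAL — a real constructive-QFT result; it is NOT the continuum limit and NOT the Clay problem.»  HONEST DEPENDENCY (verbatim):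
«continuum YM on T⁴ ⇐ BetaPertH ∧ nine spine estimates (0/9 proved); BetaPertH ⇐ (D1) ∧ (D4) ∧ CAP+tail; G-an2-4 gates asym, D1 and
NE2/3/4.»  [folklore] real analysis (geometric sums, Jordan, `sin` Taylor bounds, finite alias sums); 0 cite, 0 wall binder, no
`def … : Prop`; it discharges NOTHING of (CONV-C)'s K-slot `GAN24.CombesThomas.ConvCK 3 Lc` by itself — it is the Part-B (rate `θ = Lc⁻²`)
bookkeeping for the two SCALAR alias sums `a_κ(p)`, `σ(p)` of the capacitance matrix `Cap = [[diag(a) − (σ/2)δδ♭ᵀ, σδ],[σδ♭ᵀ, 0]]`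
(leaf-02-g4's structure theorem, `GAN24/CapacitanceClosedForm`), consumed by gan24-p1's row P1-L11 `FibreRate` together with rows Y08s/E4 of
`GAN24/Formal/LEAVES.md` v2.1.  NOT `BetaPertH`, NOT continuum, NOT Clay.  Value = kernel bookkeeping leaf toward the K-slot route P1 of binder
row G-an2-4, NOT summit progress.

## The leaf (P1-Y11s = self-row «L11b*», SKELETON-P1 node N17 `blockwise_rate` restricted to the capacitance scalars) in four parts
1. `GAN24/CapacitanceScalarRate` — the normalised one-coordinate alias weight `aw N x = ‖Σ_{t<N} e^{ixt}‖²/N²`, its continuum reference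
   `awInf q = sinc²(q/2)`, the scaled symbol `symN N q = Σ_i N²·4 sin²(q_i/(2N))`, their RELATIVE second-order comparisons on the scaled
   Brillouin zone (R1), and the product engine `mul_rel` / `prod_rel`;
2. `GAN24/CapacitanceScalarRateTerm` — the summands `fA`, `fS` of `ã_κ = a_κ/N^{D+4}`, `σ̃ = σ/N^{D+4}` versus their continuum references
   (`fA_rel`, `fS_rel`: relative rate `(π²/16)(|q|²/N²)·Kc D`), and the ALIAS WINDOWS (`zrep`, integer alias box `boxZ`, nesting in `N`);
3. `GAN24/CapacitanceScalarRateBox` — `aT N p κ = ã_κ^{(N)}(p)`, `sT N p = σ̃^{(N)}(p)` as sums over `(ℤ/N)^D` in leaf P1-L06's `kfine`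
   currency, their alias-box form, and the `N`-uniform continuum alias-sum bounds (R2) `Σ_box Π_i sinc² ≤ 3^D`;
4. `GAN24/CapacitanceScalarRateSum` — (R3) tails and (R4) the TWO-SCALE RATES `aT_rate : |ã_κ^{(N')}(p) − ã_κ^{(N)}(p)| ≤ rateA D/N²`,
   `sT_rate : |σ̃^{(N')} − σ̃^{(N)}| ≤ rateS D·(1 + |p|⁻²)/N²` for all `1 ≤ N ≤ N'`, `p ∈ [−π, π]^D ∖ {0}`.

## What is proved in this part
* §3 `pw N q = Π_i aw N (q_i/N)` (`= |S(m)|²/N^{2D}`), `fA N κ q = pw·aw N (q_κ/N)/(2·symN N q)` (the `a_κ`-summand `w_m|s_κ(m)|²/(2L_m)` in units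
  `N^{−(D+4)}`), `fS N q = pw/(symN)²` (the `σ`-summand), their continuum references `pwInf`, `fAinf`, `fSinf`, the constant
  `Kc D = (π²/4)^{D+2}`, and **`fA_rel` / `fS_rel`**: on `|q_i| ≤ πN`, `q ≠ 0`: `f∞ ≤ f_N ≤ Kc D·f∞` and
  `f_N − f∞ ≤ (π²/16)(|q|²/N²)·Kc D·f∞` (PART 1's engine applied to the `D + 2` factors);
* §4 the ZONE REPRESENTATIVE `zrep N s r` of `r ∈ ℤ/N` (`s + 2π·zrep ∈ [−πN, πN)`; `zrep_cast`, `zrep_window`, uniqueness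
  `zrep_intCast_of_window`), the integer ALIAS BOX `boxZ N p` (image of `(ℤ/N)^D`), `mem_boxZ_iff`, the re-indexing `sum_boxZ`, the NESTING
  `boxZ_subset` (`N ≤ N'`), and the geometry of alias momenta `qv p z = p + 2πz` (`abs_qv_le_of_mem_boxZ`, `pi_le_abs_qv`, `momSq_qv_pos`,
  `sq_le_momSq_of_not_mem_boxZ`: outside the level-`N` box `|q|² ≥ π²N²`).

Unit `b2b-balaban-gan24-formalise-leaf-07` (G-an2-4 formalisation swarm, leaf prover 07, gen 5), 2026-08-19.
-/

noncomputable section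

open Complex Finset
open scoped BigOperators Real

namespace Summit.QuantumFields.BalabanUV.Beta.GAN24.CapacitanceScalarRateTerm

open AliasWeights AliasWeightsSum SymbolTaylor CapacitanceScalarRate
open Literature.MathematicalPhysics.QuantumFieldTheory.King1986 (momSq momSq_nonneg)

variable {D : ℕ}

/-! ## §3 The summands of the two capacitance scalars at an alias momentum `q`, lattice vs continuum -/

/-- The product weight `Π_i aw N (q_i/N)` (`= |S(m)|²/N^{2D}` at `q = p + 2π m`). -/
def pw (N : ℕ) (q : Fin D → ℝ) : ℝ := ∏ i, aw N (q i / N)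

/-- Its continuum reference `Π_i sinc²(q_i/2)`. -/
def pwInf (q : Fin D → ℝ) : ℝ := ∏ i, awInf (q i)

/-- The `a_κ`-SUMMAND in units `N^{−(D+4)}`: `fA N κ q = (Π_i aw N (q_i/N))·aw N (q_κ/N)/(2·symN N q)`
(`= w_m|s_κ(m)|²/(2L_m) / N^{D+4}` of leaf-02's closed form at `q = p + 2πm`). -/
def fA (N : ℕ) (κ : Fin D) (q : Fin D → ℝ) : ℝ := pw N q * aw N (q κ / N) / (2 * symN N q)

/-- Its continuum reference `(Π_i sinc²(q_i/2))·sinc²(q_κ/2)/(2|q|²)`. -/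
def fAinf (κ : Fin D) (q : Fin D → ℝ) : ℝ := pwInf q * awInf (q κ) / (2 * momSq q)

/-- The `σ`-SUMMAND in units `N^{−(D+4)}`: `fS N q = (Π_i aw N (q_i/N))/(symN N q)²` (`= w_m/L_m² / N^{D+4}`). -/
def fS (N : ℕ) (q : Fin D → ℝ) : ℝ := pw N q / symN N q ^ 2

/-- Its continuum reference `(Π_i sinc²(q_i/2))/|q|⁴`. -/
def fSinf (q : Fin D → ℝ) : ℝ := pwInf q / momSq q ^ 2

/-- The product-comparison constant `Kc D = (π²/4)^{D+2}`. -/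
def Kc (D : ℕ) : ℝ := (π ^ 2 / 4) ^ (D + 2)

/-- [folklore] `1 ≤ Kc D`. -/
theorem one_le_Kc (D : ℕ) : 1 ≤ Kc D := one_le_pow₀ one_le_pi_sq_div_four

/-- [folklore] `0 ≤ pwInf q`. -/
theorem pwInf_nonneg (q : Fin D → ℝ) : 0 ≤ pwInf q := Finset.prod_nonneg fun _ _ => awInf_nonneg _

/-- [folklore] `pwInf q ≤ 1`. -/
theorem pwInf_le_one (q : Fin D → ℝ) : pwInf q ≤ 1 :=
  Finset.prod_le_one (fun _ _ => awInf_nonneg _) fun _ _ => awInf_le_one _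

/-- [folklore] `0 ≤ pw N q`. -/
theorem pw_nonneg (N : ℕ) (q : Fin D → ℝ) : 0 ≤ pw N q := Finset.prod_nonneg fun _ _ => aw_nonneg _ _

/-- [folklore] The product weight, lattice vs continuum, on the scaled zone:
`pwInf ≤ pw N ≤ (π²/4)^D·pwInf` and `pw N − pwInf ≤ (π²/48)(|q|²/N²)·(π²/4)^D·pwInf`. -/
theorem pw_rel {N : ℕ} (hN : 0 < N) {q : Fin D → ℝ} (hq : ∀ i, |q i| ≤ π * N) :
    pwInf q ≤ pw N q ∧ pw N q ≤ (π ^ 2 / 4) ^ D * pwInf q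
      ∧ pw N q - pwInf q ≤ π ^ 2 / 48 * (momSq q / (N : ℝ) ^ 2) * (π ^ 2 / 4) ^ D * pwInf q := by
  have h := prod_rel (Finset.univ : Finset (Fin D)) (a := fun i => aw N (q i / N)) (b := fun i => awInf (q i))
    (e := fun i => π ^ 2 / 48 * (q i ^ 2 / (N : ℝ) ^ 2)) (K := π ^ 2 / 4) one_le_pi_sq_div_four
    (fun i _ => awInf_nonneg _) (fun i _ => by positivity) (fun i _ => (aw_alias_bounds hN (hq i)).1)
    (fun i _ => (aw_alias_bounds hN (hq i)).2.1)
    (fun i _ => by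
      have h3 := (aw_alias_bounds hN (hq i)).2.2
      have hK := one_le_pi_sq_div_four
      have h0 : 0 ≤ π ^ 2 / 48 * (q i ^ 2 / (N : ℝ) ^ 2) * awInf (q i) := by
        have := awInf_nonneg (q i); positivity
      nlinarith)
  rw [Finset.card_univ, Fintype.card_fin] at h
  have hsum : ∑ i, π ^ 2 / 48 * (q i ^ 2 / (N : ℝ) ^ 2) = π ^ 2 / 48 * (momSq q / (N : ℝ) ^ 2) := by
    unfold momSq
    rw [← Finset.mul_sum, Finset.sum_div]
  rw [hsum] at h
  exact h

/-- [folklore] **The `a_κ`-summand, lattice vs continuum** (`|q_i| ≤ πN`, `q ≠ 0`, `N ≥ 1`):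
`fAinf ≤ fA N ≤ Kc D·fAinf` and `fA N − fAinf ≤ (π²/16)·(|q|²/N²)·Kc D·fAinf`. -/
theorem fA_rel {N : ℕ} (hN : 0 < N) {q : Fin D → ℝ} (hq : ∀ i, |q i| ≤ π * N) (hq0 : 0 < momSq q)
    (κ : Fin D) :
    fAinf κ q ≤ fA N κ q ∧ fA N κ q ≤ Kc D * fAinf κ q
      ∧ fA N κ q - fAinf κ q ≤ π ^ 2 / 16 * (momSq q / (N : ℝ) ^ 2) * Kc D * fAinf κ q := by
  have hπ := Real.pi_pos
  have hK := one_le_pi_sq_div_four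
  obtain ⟨p1, p2, p3⟩ := pw_rel hN hq
  obtain ⟨a1, a2, a3⟩ := aw_alias_bounds hN (hq κ)
  obtain ⟨r1, r2, r3⟩ := symN_inv_bounds hN hq hq0
  set eP := π ^ 2 / 48 * (momSq q / (N : ℝ) ^ 2) with heP
  set eA := π ^ 2 / 48 * (q κ ^ 2 / (N : ℝ) ^ 2) with heA
  have heP0 : 0 ≤ eP := by positivity
  have heA0 : 0 ≤ eA := by positivity
  have hR0 : 0 ≤ (momSq q)⁻¹ := by positivity
  have a3' : aw N (q κ / N) - awInf (q κ) ≤ eA * (π ^ 2 / 4) * awInf (q κ) := by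
    nlinarith [mul_nonneg heA0 (awInf_nonneg (q κ))]
  have r3' : (symN N q)⁻¹ - (momSq q)⁻¹ ≤ eP * (π ^ 2 / 4) * (momSq q)⁻¹ := by
    nlinarith [mul_nonneg heP0 hR0]
  -- stage 1: product weight × the κ-weight; stage 2: × the inverse symbol
  obtain ⟨m1, m2, m3⟩ := mul_rel (pwInf_nonneg q) (awInf_nonneg (q κ)) (one_le_pow₀ hK (n := D)) hK
    heP0 p1 p2 p3 a1 a2 a3'
  have hK1 : (1 : ℝ) ≤ (π ^ 2 / 4) ^ D * (π ^ 2 / 4) := one_le_mul_of_one_le_of_one_le (one_le_pow₀ hK) hK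
  obtain ⟨n1, n2, n3⟩ := mul_rel (mul_nonneg (pwInf_nonneg q) (awInf_nonneg (q κ))) hR0 hK1 hK
    (add_nonneg heP0 heA0) m1 m2 m3 r1 r2 r3'
  -- bookkeeping
  have hKc : (π ^ 2 / 4) ^ D * (π ^ 2 / 4) * (π ^ 2 / 4) = Kc D := by unfold Kc; ring
  rw [hKc] at n2 n3
  have hKc0 : 0 ≤ Kc D := le_trans zero_le_one (one_le_Kc D)
  have hfA : fA N κ q = pw N q * aw N (q κ / N) * (symN N q)⁻¹ / 2 := by
    unfold fA; rw [div_eq_mul_inv, mul_inv]; ring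
  have hfAinf : fAinf κ q = pwInf q * awInf (q κ) * (momSq q)⁻¹ / 2 := by
    unfold fAinf; rw [div_eq_mul_inv, mul_inv]; ring
  have he : eP + eA + eP ≤ π ^ 2 / 16 * (momSq q / (N : ℝ) ^ 2) := by
    have hκ : q κ ^ 2 ≤ momSq q := by
      unfold momSq
      exact Finset.single_le_sum (f := fun i => q i ^ 2) (fun i _ => sq_nonneg (q i)) (Finset.mem_univ κ)
    have : eA ≤ π ^ 2 / 48 * (momSq q / (N : ℝ) ^ 2) := by
      rw [heA]
      exact mul_le_mul_of_nonneg_left (div_le_div_of_nonneg_right hκ (sq_nonneg _)) (by positivity)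
    linarith [heP, this]
  have hbase : 0 ≤ pwInf q * awInf (q κ) * (momSq q)⁻¹ :=
    mul_nonneg (mul_nonneg (pwInf_nonneg q) (awInf_nonneg _)) hR0
  have n3' : pw N q * aw N (q κ / N) * (symN N q)⁻¹ - pwInf q * awInf (q κ) * (momSq q)⁻¹
      ≤ π ^ 2 / 16 * (momSq q / (N : ℝ) ^ 2) * Kc D * (pwInf q * awInf (q κ) * (momSq q)⁻¹) :=
    n3.trans (mul_le_mul_of_nonneg_right (mul_le_mul_of_nonneg_right he hKc0) hbase)
  rw [hfA, hfAinf]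
  refine ⟨by linarith, ?_, ?_⟩
  · have e : Kc D * (pwInf q * awInf (q κ) * (momSq q)⁻¹ / 2)
        = Kc D * (pwInf q * awInf (q κ) * (momSq q)⁻¹) / 2 := by ring
    rw [e]; linarith
  · have e : π ^ 2 / 16 * (momSq q / (N : ℝ) ^ 2) * Kc D * (pwInf q * awInf (q κ) * (momSq q)⁻¹ / 2)
        = π ^ 2 / 16 * (momSq q / (N : ℝ) ^ 2) * Kc D * (pwInf q * awInf (q κ) * (momSq q)⁻¹) / 2 := by ring
    rw [e]; linarith

/-- [folklore] **The `σ`-summand, lattice vs continuum** (`|q_i| ≤ πN`, `q ≠ 0`, `N ≥ 1`):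
`fSinf ≤ fS N ≤ Kc D·fSinf` and `fS N − fSinf ≤ (π²/16)·(|q|²/N²)·Kc D·fSinf`. -/
theorem fS_rel {N : ℕ} (hN : 0 < N) {q : Fin D → ℝ} (hq : ∀ i, |q i| ≤ π * N) (hq0 : 0 < momSq q) :
    fSinf q ≤ fS N q ∧ fS N q ≤ Kc D * fSinf q
      ∧ fS N q - fSinf q ≤ π ^ 2 / 16 * (momSq q / (N : ℝ) ^ 2) * Kc D * fSinf q := by
  have hπ := Real.pi_pos
  have hK := one_le_pi_sq_div_four
  obtain ⟨p1, p2, p3⟩ := pw_rel hN hq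
  obtain ⟨r1, r2, r3⟩ := symN_inv_bounds hN hq hq0
  set eP := π ^ 2 / 48 * (momSq q / (N : ℝ) ^ 2) with heP
  have heP0 : 0 ≤ eP := by positivity
  have hR0 : 0 ≤ (momSq q)⁻¹ := by positivity
  have r3' : (symN N q)⁻¹ - (momSq q)⁻¹ ≤ eP * (π ^ 2 / 4) * (momSq q)⁻¹ := by
    nlinarith [mul_nonneg heP0 hR0]
  obtain ⟨m1, m2, m3⟩ := mul_rel (pwInf_nonneg q) hR0 (one_le_pow₀ hK (n := D)) hK heP0 p1 p2 p3 r1 r2 r3'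
  have hK1 : (1 : ℝ) ≤ (π ^ 2 / 4) ^ D * (π ^ 2 / 4) := one_le_mul_of_one_le_of_one_le (one_le_pow₀ hK) hK
  obtain ⟨n1, n2, n3⟩ := mul_rel (mul_nonneg (pwInf_nonneg q) hR0) hR0 hK1 hK (add_nonneg heP0 heP0)
    m1 m2 m3 r1 r2 r3'
  have hKc : (π ^ 2 / 4) ^ D * (π ^ 2 / 4) * (π ^ 2 / 4) = Kc D := by unfold Kc; ring
  rw [hKc] at n2 n3
  have hKc0 : 0 ≤ Kc D := le_trans zero_le_one (one_le_Kc D)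
  have hfS : fS N q = pw N q * (symN N q)⁻¹ * (symN N q)⁻¹ := by
    unfold fS; rw [div_eq_mul_inv, sq, mul_inv]; ring
  have hfSinf : fSinf q = pwInf q * (momSq q)⁻¹ * (momSq q)⁻¹ := by
    unfold fSinf; rw [div_eq_mul_inv, sq, mul_inv]; ring
  have he : eP + eP + eP ≤ π ^ 2 / 16 * (momSq q / (N : ℝ) ^ 2) := by rw [heP]; linarith
  have hbase : 0 ≤ pwInf q * (momSq q)⁻¹ * (momSq q)⁻¹ := mul_nonneg (mul_nonneg (pwInf_nonneg q) hR0) hR0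
  rw [hfS, hfSinf]
  exact ⟨n1, n2, n3.trans (mul_le_mul_of_nonneg_right (mul_le_mul_of_nonneg_right he hKc0) hbase)⟩


/-! ## §4 Alias windows: zone representatives of `ℤ/N`, the integer alias box, re-indexing and nesting -/

/-- The ZONE REPRESENTATIVE of a residue `r ∈ ℤ/N` for a momentum coordinate `s ∈ [−π, π]`: the unique integer `z ≡ r (mod N)`
with `s + 2πz ∈ [−πN, πN)` (the balanced representative `valMinAbs`, shifted by `∓N` at the two zone edges). -/
def zrep (N : ℕ) (s : ℝ) (r : ZMod N) : ℤ :=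
  if π * N ≤ s + 2 * π * r.valMinAbs then r.valMinAbs - N
  else if s + 2 * π * r.valMinAbs < -(π * N) then r.valMinAbs + N else r.valMinAbs

/-- [folklore] `zrep N s r ≡ r (mod N)`. -/
theorem zrep_cast {N : ℕ} [NeZero N] (s : ℝ) (r : ZMod N) : ((zrep N s r : ℤ) : ZMod N) = r := by
  unfold zrep
  split_ifs <;> simp [ZMod.coe_valMinAbs]

/-- [folklore] The zone representative lies in the window: `−πN ≤ s + 2π·zrep N s r < πN` (`|s| ≤ π`, `N ≥ 1`). -/
theorem zrep_window {N : ℕ} [NeZero N] {s : ℝ} (hs : |s| ≤ π) (r : ZMod N) :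
    -(π * N) ≤ s + 2 * π * (zrep N s r : ℝ) ∧ s + 2 * π * (zrep N s r : ℝ) < π * N := by
  have hπ := Real.pi_pos
  have hN : (1 : ℝ) ≤ N := by exact_mod_cast Nat.one_le_iff_ne_zero.2 (NeZero.ne N)
  have hv := r.valMinAbs_mem_Ioc
  have hv1 : -(N : ℝ) < 2 * (r.valMinAbs : ℝ) := by
    have := hv.1; exact_mod_cast (by linarith : -(N : ℤ) < 2 * r.valMinAbs)
  have hv2 : 2 * (r.valMinAbs : ℝ) ≤ N := by
    have := hv.2; exact_mod_cast (by linarith : 2 * r.valMinAbs ≤ (N : ℤ))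
  have hs1 := (abs_le.1 hs).1
  have hs2 := (abs_le.1 hs).2
  unfold zrep
  split_ifs with h1 h2
  · push_cast
    constructor <;> nlinarith
  · push_cast
    constructor <;> nlinarith
  · push Not at h1 h2
    exact ⟨h2, h1⟩

/-- [folklore] A window element is bounded by `πN` in absolute value. -/
theorem abs_le_of_window {N : ℕ} {s : ℝ} {z : ℤ} (h : -(π * N) ≤ s + 2 * π * (z : ℝ) ∧ s + 2 * π * (z : ℝ) < π * N) :
    |s + 2 * π * (z : ℝ)| ≤ π * N :=
  abs_le.2 ⟨h.1, h.2.le⟩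

/-- [folklore] UNIQUENESS: an integer `z` in the window is the zone representative of its residue. -/
theorem zrep_intCast_of_window {N : ℕ} [NeZero N] {s : ℝ} (hs : |s| ≤ π) {z : ℤ}
    (h : -(π * N) ≤ s + 2 * π * (z : ℝ) ∧ s + 2 * π * (z : ℝ) < π * N) : zrep N s (z : ZMod N) = z := by
  have hπ := Real.pi_pos
  set w := zrep N s (z : ZMod N) with hw
  have hwin := zrep_window hs (z : ZMod N)
  rw [← hw] at hwin
  have hdvd : (N : ℤ) ∣ (w - z) := by
    rw [← ZMod.intCast_zmod_eq_zero_iff_dvd, Int.cast_sub, hw, zrep_cast, sub_self]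
  obtain ⟨k, hk⟩ := hdvd
  have hkR : (w : ℝ) - z = (N : ℝ) * k := by exact_mod_cast hk
  have hN : (0 : ℝ) < N := by exact_mod_cast Nat.pos_of_ne_zero (NeZero.ne N)
  -- |w - z| < N forces k = 0
  have hlt : |(k : ℝ)| < 1 := by
    rw [abs_lt]
    constructor <;> nlinarith [hwin.1, hwin.2, h.1, h.2]
  have hk0 : k = 0 := by
    have h1 : (k : ℝ) < 1 := (abs_lt.1 hlt).2
    have h2 : (-1 : ℝ) < k := (abs_lt.1 hlt).1
    have h1' : k < 1 := by exact_mod_cast h1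
    have h2' : -1 < k := by exact_mod_cast h2
    omega
  rw [hk0, mul_zero] at hk
  linarith [hk]

/-- The alias momentum vector of an integer alias `z`: `qv p z = p + 2π z`. -/
def qv (p : Fin D → ℝ) (z : Fin D → ℤ) : Fin D → ℝ := fun i => p i + 2 * π * (z i : ℝ)

/-- The vector of zone representatives of `m ∈ (ℤ/N)^D`. -/
def zvec (N : ℕ) (p : Fin D → ℝ) (m : Fin D → ZMod N) : Fin D → ℤ := fun i => zrep N (p i) (m i)

/-- The INTEGER ALIAS BOX at level `N`: the zone representatives of all `m ∈ (ℤ/N)^D`. -/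
def boxZ (N : ℕ) [NeZero N] (p : Fin D → ℝ) : Finset (Fin D → ℤ) := Finset.univ.image (zvec N p)

/-- [folklore] `zvec N p` is injective. -/
theorem zvec_injective {N : ℕ} [NeZero N] (p : Fin D → ℝ) : Function.Injective (zvec N p) := by
  intro m m' h
  funext i
  have hi := congrFun h i
  simp only [zvec] at hi
  have := congrArg (fun z : ℤ => (z : ZMod N)) hi
  simpa [zrep_cast] using this

/-- [folklore] MEMBERSHIP: `z ∈ boxZ N p` iff every coordinate of `p + 2πz` lies in the window `[−πN, πN)` (`p ∈ [−π, π]^D`). -/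
theorem mem_boxZ_iff {N : ℕ} [NeZero N] {p : Fin D → ℝ} (hp : ∀ i, |p i| ≤ π) {z : Fin D → ℤ} :
    z ∈ boxZ N p ↔ ∀ i, -(π * N) ≤ p i + 2 * π * (z i : ℝ) ∧ p i + 2 * π * (z i : ℝ) < π * N := by
  unfold boxZ
  rw [Finset.mem_image]
  constructor
  · rintro ⟨m, -, rfl⟩ i
    exact zrep_window (hp i) (m i)
  · intro h
    refine ⟨fun i => ((z i : ℤ) : ZMod N), Finset.mem_univ _, ?_⟩
    funext i
    exact zrep_intCast_of_window (hp i) (h i)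

/-- [folklore] RE-INDEXING: a sum over the integer alias box is the sum over `(ℤ/N)^D`. -/
theorem sum_boxZ {N : ℕ} [NeZero N] (p : Fin D → ℝ) (F : (Fin D → ℤ) → ℝ) :
    ∑ z ∈ boxZ N p, F z = ∑ m : Fin D → ZMod N, F (zvec N p m) := by
  unfold boxZ
  rw [Finset.sum_image fun m _ m' _ h => zvec_injective p h]

/-- [folklore] NESTING: the alias box of level `N` sits inside the alias box of every level `N' ≥ N` (same `p`). -/
theorem boxZ_subset {N N' : ℕ} [NeZero N] [NeZero N'] {p : Fin D → ℝ} (hp : ∀ i, |p i| ≤ π) (hNN' : N ≤ N') :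
    boxZ N p ⊆ boxZ N' p := by
  intro z hz
  rw [mem_boxZ_iff hp] at hz ⊢
  have h : (N : ℝ) ≤ N' := by exact_mod_cast hNN'
  have hπ := Real.pi_pos
  intro i
  constructor <;> nlinarith [(hz i).1, (hz i).2]

/-- [folklore] In the box, every alias coordinate is in the scaled zone: `|p_i + 2πz_i| ≤ πN`. -/
theorem abs_qv_le_of_mem_boxZ {N : ℕ} [NeZero N] {p : Fin D → ℝ} (hp : ∀ i, |p i| ≤ π) {z : Fin D → ℤ}
    (hz : z ∈ boxZ N p) (i : Fin D) : |qv p z i| ≤ π * N :=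
  abs_le_of_window ((mem_boxZ_iff hp).1 hz i)

/-- [folklore] A NONZERO integer alias coordinate is far from the origin: `π ≤ |p_i + 2πz_i|` for `z_i ≠ 0`, `|p_i| ≤ π`. -/
theorem pi_le_abs_qv {p : Fin D → ℝ} (hp : ∀ i, |p i| ≤ π) {z : Fin D → ℤ} {i : Fin D} (hz : z i ≠ 0) :
    π ≤ |qv p z i| := by
  have hπ := Real.pi_pos
  have hp1 := (abs_le.1 (hp i)).1
  have hp2 := (abs_le.1 (hp i)).2
  unfold qv
  rcases lt_or_gt_of_ne hz with h | h
  · have h' : (z i : ℝ) ≤ -1 := by exact_mod_cast Int.le_sub_one_of_lt h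
    rw [abs_of_nonpos (by nlinarith)]
    nlinarith
  · have h' : (1 : ℝ) ≤ z i := by exact_mod_cast h
    rw [abs_of_nonneg (by nlinarith)]
    nlinarith

/-- [folklore] For `p ≠ 0` in the zone, every alias momentum is nonzero: `0 < |p + 2πz|²`. -/
theorem momSq_qv_pos {p : Fin D → ℝ} (hp : ∀ i, |p i| ≤ π) (hp0 : p ≠ 0) (z : Fin D → ℤ) : 0 < momSq (qv p z) := by
  have hπ := Real.pi_pos
  by_cases hz : z = 0
  · subst hz
    obtain ⟨i, hi⟩ : ∃ i, p i ≠ 0 := by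
      by_contra h; push Not at h; exact hp0 (funext h)
    unfold momSq
    refine lt_of_lt_of_le (by positivity : 0 < p i ^ 2) ?_
    have : qv p 0 i = p i := by simp [qv]
    rw [← this]
    exact Finset.single_le_sum (f := fun j => qv p 0 j ^ 2) (fun j _ => sq_nonneg _) (Finset.mem_univ i)
  · obtain ⟨i, hi⟩ : ∃ i, z i ≠ 0 := by
      by_contra h; push Not at h; exact hz (funext h)
    have hq := pi_le_abs_qv hp hi
    unfold momSq
    refine lt_of_lt_of_le (by positivity : 0 < π ^ 2) ?_
    calc π ^ 2 ≤ qv p z i ^ 2 := by rw [← sq_abs (qv p z i)]; exact pow_le_pow_left₀ hπ.le hq 2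
      _ ≤ ∑ j, qv p z j ^ 2 := Finset.single_le_sum (f := fun j => qv p z j ^ 2) (fun j _ => sq_nonneg _) (Finset.mem_univ i)

/-- [folklore] Outside the level-`N` box (but at momentum `p ∈ [−π,π]^D`) some coordinate has `|q_i| ≥ πN`, so `|q|² ≥ π²N²`. -/
theorem sq_le_momSq_of_not_mem_boxZ {N : ℕ} [NeZero N] {p : Fin D → ℝ} (hp : ∀ i, |p i| ≤ π) {z : Fin D → ℤ}
    (hz : z ∉ boxZ N p) : (π * N) ^ 2 ≤ momSq (qv p z) := by
  rw [mem_boxZ_iff hp] at hz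
  push Not at hz
  obtain ⟨i, hi⟩ := hz
  have hπ := Real.pi_pos
  have habs : π * N ≤ |qv p z i| := by
    unfold qv
    by_cases h : -(π * N) ≤ p i + 2 * π * (z i : ℝ)
    · exact le_trans (hi h) (le_abs_self _)
    · push Not at h
      rw [abs_of_neg (by nlinarith [hπ])]
      linarith
  unfold momSq
  calc (π * N) ^ 2 ≤ qv p z i ^ 2 := by
        rw [← sq_abs (qv p z i)]; exact pow_le_pow_left₀ (by positivity) habs 2
    _ ≤ ∑ j, qv p z j ^ 2 := Finset.single_le_sum (f := fun j => qv p z j ^ 2) (fun j _ => sq_nonneg _) (Finset.mem_univ i)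

end Summit.QuantumFields.BalabanUV.Beta.GAN24.CapacitanceScalarRateTerm

end
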